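import Summits.Ventures.HSemireg.WedgeHankelRecurrenceModule
import Summits.Ventures.HSemireg.WedgeHankelTwoNodesShear
import Summits.Ventures.HSemireg.WedgeHankelScale

/-!
# Venture HSemireg — THE SUBSTITUTIONS ACT ON RECURRENCES AS ON BINARY FORMS: the generators of the substitution group move the recurrence space `Rec_k(q) ⊆ K[X]_{≤k}` by
# **translation `Rec_k(expMul λ q) = taylor(−λ)·Rec_k(q)`**, **dilation `p ∈ Rec_k(scaleSeq μ q) ↔ p(μX) ∈ Rec_k(q)`** and **inversion `p ∈ Rec_k(rev_N q) ↔ reflect_k p ∈ Rec_k(q)`**;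
# the MOMENT FORM `p ∈ Rec_k(q) ↔ ⟪g·p, q⟫_0 = 0 ∀ deg g ≤ N − k`

HONEST FRAMING. Part of the Lean index of the computation cell `pub-hsemireg` (seat p10 gen 26, Sunday typer «UNIFORM-IN-n»).
LINEAR ALGEBRA OF HANKEL (catalecticant) MATRICES and of polynomials over a field ONLY: no variety, no cohomology theory, no sheaf, no Ext group and no semiregularity map is constructed
here; nothing here says that HC / HC_CM / HC_AV holds; no Literature fact is declared or used.  Custodian versions as in `WedgeHankelSiegelIdeal` (1/3); the dictionary (`expMul λ`,
`scaleSeq μ`, `rev_N` = the translation `t ↦ t + λ`, dilation `t ↦ μt` and inversion `t ↦ 1/t` of the node coordinate on the rational normal curve, E9/E12/H1; `Rec_k(q) ⊆ K[X]_{≤k}` read as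
binary `k`-forms) is QUOTED, never asserted.

WHAT IS IN THE TREE / KEYED.  N18 (`WedgeHankelRecurrenceModule`, № 173): `hkFun`, `recSpace`, `mem_recSpace_iff`, `hkFun_X_pow_mul`, `mul_mem_recSpace_add`, `recSpace_eq_degreeLT_of_lt`,
`natDegree_le_of_mem_recSpace`; gen 15's `HankelFrameChange.expMul` / `expMul_eq_sum` (Pascal), E9 (`WedgeHankelTwoNodesShear`, tree) `expMul_expMul`, `expMul_zero_left`; E12
(`WedgeHankelScale`, tree) `scaleSeq`; `WedgeHankelSwap.rev` / `rev_apply_of_le`.  Mathlib: `Polynomial.taylor` (`taylor_monomial`, `taylor_mul`, `taylor_pow`, `taylor_taylor`, `natDegree_taylor`,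
`coeff_X_add_C_pow`), `Polynomial.comp_C_mul_X_coeff`, `Polynomial.reflect` / `coeff_reflect` / `revAt_le`, `Finset.sum_range_reflect`.
THIS FILE (namespace `Summit.Ventures.HSemireg.Wedge.HankelOuter` continued; CHAINED on N18; 0 definitions):
* §479 `hkFun_zero_mul_eq_zero_of_mem_recSpace` (`k ≤ N`, `p ∈ Rec_k(q)`, `deg g ≤ N − k ⇒ ⟪g·p, q⟫_0 = 0`), THE MOMENT FORM **`mem_recSpace_iff_forall_mul`**
  (`p ∈ Rec_k(q) ↔ deg p ≤ k ∧ ∀ deg g ≤ N − k, ⟪g·p, q⟫_0 = 0`).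
* §480 TRANSLATION: **`hkFun_expMul_zero`** (`⟪p, expMul λ q⟫_0 = ⟪taylor λ p, q⟫_0`), `taylor_X_sub_C_pow_mul_hankel`, `taylor_mem_recSpace_of_mem_recSpace_expMul`, **`mem_recSpace_expMul_iff`**
  (`p ∈ Rec_k(expMul λ q) ↔ taylor λ p ∈ Rec_k(q)`, every `k`, `λ`, `q`), **`recSpace_expMul_eq_map_taylor`** (`Rec_k(expMul λ q) = (Rec_k q).map (taylor (−λ))`),
  `recSpace_expMul_eq_span_of_eq_span` (the minimal recurrence translates: `K·m ↦ K·taylor(−λ) m`).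
* §481 DILATION: **`hkFun_scaleSeq`** (`⟪p, scaleSeq μ q⟫_s = μ^s ⟪p(μX), q⟫_s`), **`mem_recSpace_scaleSeq_iff`** (`μ ≠ 0`: `p ∈ Rec_k(scaleSeq μ q) ↔ p(μX) ∈ Rec_k(q)`).
* §482 INVERSION: **`hkFun_rev`** (`deg p ≤ k`, `s + k ≤ N`: `⟪p, rev_N q⟫_s = ⟪reflect_k p, q⟫_{N−k−s}`), **`mem_recSpace_rev_iff`** (`deg p ≤ k`: `p ∈ Rec_k(rev_N q) ↔ reflect_k p ∈ Rec_k(q)`),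
  `one_mem_recSpace_rev_iff` (`1 ∈ Rec_k(rev_N q) ↔ X^k ∈ Rec_k(q)`: the node at infinity has a CONSTANT minimal recurrence — the degree drop below `R` seen in N18 is the point `∞`).
READING: with N19/N20 (the minimal recurrence of a divisor class is its divisor polynomial) these laws say the substitution group moves recurrences exactly as it moves binary forms /
divisors on `P¹` — `expMul λ`: roots `ν ↦ ν + λ`, `scaleSeq μ`: `ν ↦ μν`, `rev_N`: `ν ↦ 1/ν` (reflection of the `k`-form) — the polynomial shadow of H1/E9/E12's transport of kernels.
Nothing Ext-side.  New names only.
-/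

open Module Polynomial
open scoped Matrix Polynomial

namespace Summit.Ventures.HSemireg.Wedge.HankelOuter

open Summit.Ventures.HSemireg.Wedge Summit.Ventures.HSemireg.Wedge.Hankel Summit.Ventures.HSemireg.Wedge.HankelFrameChange

variable (K : Type*) [Field K] {N : ℕ}

/-! ## §479. The moment form of the recurrence space: `p ∈ Rec_k(q)` iff `⟪g·p, q⟫_0 = 0` for every test polynomial `g` of degree `≤ N − k` -/

/-- a recurrence multiplied by a test polynomial of complementary degree has vanishing zeroth moment. -/
theorem hkFun_zero_mul_eq_zero_of_mem_recSpace {k : ℕ} (hk : k ≤ N) {q : ℕ → K} {p g : K[X]} (hp : p ∈ recSpace K N q k)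
    (hg : g ∈ Polynomial.degreeLT K (N - k + 1)) : hkFun K q 0 (g * p) = 0 := by
  have h := mul_mem_recSpace_add K hg hp
  rw [show k + (N - k) = N by omega, mem_recSpace_iff] at h
  exact h.2 0 (by omega)

/-- **THE MOMENT FORM: for `k ≤ N`, `p ∈ Rec_k(q)` iff `deg p ≤ k` and `⟪g · p, q⟫_0 = 0` for all `g` with `deg g ≤ N − k`.** -/
theorem mem_recSpace_iff_forall_mul {k : ℕ} (hk : k ≤ N) (q : ℕ → K) (p : K[X]) :
    p ∈ recSpace K N q k ↔ p ∈ Polynomial.degreeLT K (k + 1) ∧ ∀ g ∈ Polynomial.degreeLT K (N - k + 1), hkFun K q 0 (g * p) = 0 := by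
  constructor
  · exact fun hp => ⟨recSpace_le_degreeLT K q k hp, fun g hg => hkFun_zero_mul_eq_zero_of_mem_recSpace K hk hp hg⟩
  · rintro ⟨hdeg, h⟩
    rw [mem_recSpace_iff]
    refine ⟨hdeg, fun s hs => ?_⟩
    have := h (Polynomial.X ^ s) ((mem_degreeLT_succ_iff K).mpr (by rw [Polynomial.natDegree_X_pow]; omega))
    rwa [hkFun_X_pow_mul, zero_add] at this

/-! ## §480. Translation of the node: `Rec_k(expMul λ q) = taylor(−λ) · Rec_k(q)` -/

/-- **`⟪p, expMul λ q⟫_0 = ⟪taylor λ p, q⟫_0`**: the zeroth moment of `exp(λΘ)·v` against `p` is the zeroth moment of `v` against `p(X + λ)` (Pascal). -/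
theorem hkFun_expMul_zero (lam : K) (q : ℕ → K) (p : K[X]) : hkFun K (expMul K lam q) 0 p = hkFun K q 0 (Polynomial.taylor lam p) := by
  induction p using Polynomial.induction_on' with
  | add p p' hp hp' => simp only [map_add, hp, hp']
  | monomial i c =>
    rw [hkFun_monomial, Polynomial.taylor_monomial, Polynomial.C_mul', map_smul, smul_eq_mul, add_zero, expMul_eq_sum,
      hkFun_eq_sum_range K q 0 (n := i + 1) (by rw [(Polynomial.monic_X_add_C lam).natDegree_pow, Polynomial.natDegree_X_add_C, mul_one]; omega)]
    simp only [Finset.mul_sum]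
    exact Finset.sum_congr rfl fun l _ => by rw [Polynomial.coeff_X_add_C_pow, add_zero]; ring

/-- `taylor λ ((X − λ)^s · p) = X^s · taylor λ p`. -/
theorem taylor_X_sub_C_pow_mul_hankel (lam : K) (s : ℕ) (p : K[X]) :
    Polynomial.taylor lam ((Polynomial.X - Polynomial.C lam) ^ s * p) = Polynomial.X ^ s * Polynomial.taylor lam p := by
  rw [Polynomial.taylor_mul, Polynomial.taylor_pow, map_sub, Polynomial.taylor_X, Polynomial.taylor_C, add_sub_cancel_right]

/-- `p ∈ Rec_k(expMul λ q) ⇒ taylor λ p ∈ Rec_k(q)` (`k ≤ N`). -/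
theorem taylor_mem_recSpace_of_mem_recSpace_expMul {k : ℕ} (hk : k ≤ N) (lam : K) {q : ℕ → K} {p : K[X]} (hp : p ∈ recSpace K N (expMul K lam q) k) :
    Polynomial.taylor lam p ∈ recSpace K N q k := by
  rw [mem_recSpace_iff]
  refine ⟨(mem_degreeLT_succ_iff K).mpr (by rw [Polynomial.natDegree_taylor]; exact natDegree_le_of_mem_recSpace K hp), fun s hs => ?_⟩
  rw [← zero_add s, ← hkFun_X_pow_mul, ← taylor_X_sub_C_pow_mul_hankel, ← hkFun_expMul_zero]
  exact hkFun_zero_mul_eq_zero_of_mem_recSpace K hk hp ((mem_degreeLT_succ_iff K).mpr (by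
    rw [(Polynomial.monic_X_sub_C lam).natDegree_pow, Polynomial.natDegree_X_sub_C, mul_one]; omega))

/-- **THE TRANSLATION LAW: `p ∈ Rec_k(expMul λ q) ↔ taylor λ p ∈ Rec_k(q)`** (every `k`, `λ`, `q`; quoted: moving the node by `λ` translates the recurrence polynomial). -/
theorem mem_recSpace_expMul_iff (k : ℕ) (lam : K) (q : ℕ → K) (p : K[X]) :
    p ∈ recSpace K N (expMul K lam q) k ↔ Polynomial.taylor lam p ∈ recSpace K N q k := by
  rcases le_or_gt k N with hk | hk
  · refine ⟨taylor_mem_recSpace_of_mem_recSpace_expMul K hk lam, fun h => ?_⟩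
    have h' := taylor_mem_recSpace_of_mem_recSpace_expMul K hk (-lam) (q := expMul K lam q) (p := Polynomial.taylor lam p)
      (by rwa [show expMul K (-lam) (expMul K lam q) = q by funext j; rw [expMul_expMul, neg_add_cancel, expMul_zero_left]])
    rwa [Polynomial.taylor_taylor, neg_add_cancel, Polynomial.taylor_zero] at h'
  · rw [recSpace_eq_degreeLT_of_lt K hk, recSpace_eq_degreeLT_of_lt K hk, mem_degreeLT_succ_iff, mem_degreeLT_succ_iff, Polynomial.natDegree_taylor]

/-- equivalently **`Rec_k(expMul λ q) = taylor(−λ) · Rec_k(q)`**. -/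
theorem recSpace_expMul_eq_map_taylor (k : ℕ) (lam : K) (q : ℕ → K) :
    recSpace K N (expMul K lam q) k = (recSpace K N q k).map (Polynomial.taylor (-lam)) := by
  ext p
  rw [mem_recSpace_expMul_iff, Submodule.mem_map]
  constructor
  · intro h
    exact ⟨_, h, by rw [Polynomial.taylor_taylor, neg_add_cancel, Polynomial.taylor_zero]⟩
  · rintro ⟨p', hp', rfl⟩
    rwa [Polynomial.taylor_taylor, add_neg_cancel, Polynomial.taylor_zero]

/-- the minimal recurrence translates: `Rec_r(q) = K · m ⇒ Rec_r(expMul λ q) = K · taylor(−λ) m`. -/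
theorem recSpace_expMul_eq_span_of_eq_span {r : ℕ} (lam : K) {q : ℕ → K} {m : K[X]} (h : recSpace K N q r = K ∙ m) :
    recSpace K N (expMul K lam q) r = K ∙ Polynomial.taylor (-lam) m := by
  rw [recSpace_expMul_eq_map_taylor, h, Submodule.map_span, Set.image_singleton]

/-! ## §481. Dilation of the node coordinate: `p ∈ Rec_k(scaleSeq μ q) ↔ p(μX) ∈ Rec_k(q)` -/

/-- **`⟪p, scaleSeq μ q⟫_s = μ^s · ⟪p(μX), q⟫_s`.** -/
theorem hkFun_scaleSeq (mu : K) (q : ℕ → K) (s : ℕ) (p : K[X]) :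
    hkFun K (scaleSeq K mu q) s p = mu ^ s * hkFun K q s (p.comp (Polynomial.C mu * Polynomial.X)) := by
  have hdeg : (p.comp (Polynomial.C mu * Polynomial.X)).natDegree < p.natDegree + 1 :=
    Nat.lt_succ_of_le ((Polynomial.natDegree_comp_le).trans (by
      rcases eq_or_ne mu 0 with rfl | hmu
      · simp
      · rw [Polynomial.natDegree_C_mul_X mu hmu, mul_one]))
  rw [hkFun_eq_sum_range K _ s (Nat.lt_succ_self p.natDegree), hkFun_eq_sum_range K q s hdeg, Finset.mul_sum]
  exact Finset.sum_congr rfl fun i _ => by rw [Polynomial.comp_C_mul_X_coeff, scaleSeq, pow_add]; ring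

/-- **THE DILATION LAW: `p ∈ Rec_k(scaleSeq μ q) ↔ p(μX) ∈ Rec_k(q)`** for `μ ≠ 0`. -/
theorem mem_recSpace_scaleSeq_iff {mu : K} (hmu : mu ≠ 0) (k : ℕ) (q : ℕ → K) (p : K[X]) :
    p ∈ recSpace K N (scaleSeq K mu q) k ↔ p.comp (Polynomial.C mu * Polynomial.X) ∈ recSpace K N q k := by
  have hdeg : (p.comp (Polynomial.C mu * Polynomial.X)).natDegree = p.natDegree := by
    rw [Polynomial.natDegree_comp, Polynomial.natDegree_C_mul_X mu hmu, mul_one]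
  rw [mem_recSpace_iff, mem_recSpace_iff, mem_degreeLT_succ_iff, mem_degreeLT_succ_iff, hdeg]
  refine and_congr Iff.rfl (forall_congr' fun s => forall_congr' fun _ => ?_)
  rw [hkFun_scaleSeq, mul_eq_zero, or_iff_right (pow_ne_zero s hmu)]

/-! ## §482. The point at infinity: `p ∈ Rec_k(rev_N q) ↔ reflect_k p ∈ Rec_k(q)` -/

/-- **`⟪p, rev_N q⟫_s = ⟪reflect_k p, q⟫_{N−k−s}`** for `deg p ≤ k` and `s + k ≤ N` (reversing the coefficient sequence reflects the window). -/
theorem hkFun_rev {k : ℕ} {p : K[X]} (hp : p ∈ Polynomial.degreeLT K (k + 1)) {s : ℕ} (hs : s + k ≤ N) (q : ℕ → K) :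
    hkFun K (rev K N q) s p = hkFun K q (N - k - s) (Polynomial.reflect k p) := by
  have hdeg : p.natDegree < k + 1 := Nat.lt_succ_of_le ((mem_degreeLT_succ_iff K).mp hp)
  have hdeg' : (Polynomial.reflect k p).natDegree < k + 1 :=
    Nat.lt_succ_of_le (Polynomial.natDegree_reflect_le.trans (max_le le_rfl (by omega)))
  rw [hkFun_eq_sum_range K _ s hdeg, hkFun_eq_sum_range K q _ hdeg', ← Finset.sum_range_reflect _ (k + 1)]
  refine Finset.sum_congr rfl fun i hi => ?_
  have hi' := Finset.mem_range.mp hi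
  rw [Polynomial.coeff_reflect, Polynomial.revAt_le (by omega), rev_apply_of_le K (by omega),
    show k + 1 - 1 - i = k - i by omega, show N - (k - i + s) = i + (N - k - s) by omega]

/-- **THE INVERSION LAW: for `deg p ≤ k`, `p ∈ Rec_k(rev_N q) ↔ reflect_k p ∈ Rec_k(q)`** (the node at infinity: reversing `q` is the substitution `t ↦ 1/t`). -/
theorem mem_recSpace_rev_iff (k : ℕ) (q : ℕ → K) {p : K[X]} (hp : p ∈ Polynomial.degreeLT K (k + 1)) :
    p ∈ recSpace K N (rev K N q) k ↔ Polynomial.reflect k p ∈ recSpace K N q k := by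
  have hp' : Polynomial.reflect k p ∈ Polynomial.degreeLT K (k + 1) :=
    (mem_degreeLT_succ_iff K).mpr (Polynomial.natDegree_reflect_le.trans (max_le le_rfl ((mem_degreeLT_succ_iff K).mp hp)))
  rw [mem_recSpace_iff, mem_recSpace_iff]
  refine ⟨fun h => ⟨hp', fun s hs => ?_⟩, fun h => ⟨hp, fun s hs => ?_⟩⟩
  · have := h.2 (N - k - s) (by omega)
    rwa [hkFun_rev K hp (by omega), show N - k - (N - k - s) = s by omega] at this
  · rw [hkFun_rev K hp hs]
    exact h.2 _ (by omega)

/-- the spike at the top: `rev_N δ_0 = δ_N` has the CONSTANT recurrence — `1 ∈ Rec_k(rev_N q)` iff `X^k ∈ Rec_k(q)` (a minimal recurrence of degree `< R` signals the node at infinity). -/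
theorem one_mem_recSpace_rev_iff (k : ℕ) (q : ℕ → K) :
    (1 : K[X]) ∈ recSpace K N (rev K N q) k ↔ Polynomial.X ^ k ∈ recSpace K N q k := by
  rw [mem_recSpace_rev_iff K k q ((mem_degreeLT_succ_iff K).mpr (by rw [Polynomial.natDegree_one]; exact Nat.zero_le k)),
    show (1 : K[X]) = Polynomial.X ^ 0 by rw [pow_zero], Polynomial.reflect_monomial, Polynomial.revAt_le (Nat.zero_le k), Nat.sub_zero]

end Summit.Ventures.HSemireg.Wedge.HankelOuter
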